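import Summits.BirchSwinnertonDyer.BirchSwinnertonDyer.Theorems.ErratumRoadFiveTateTorsionRigidityZpTower
import HarnessLib

/-!
# Route `ErratumRoadFive` (K2, `p ≥ 5`), crux (T) `Rest3TorsionBranchAtFive` (item
# stmt-BirchSwinnertonDyer-19702): (L1) for a local character with OPEN IMAGE — a Tate curve acquires no new
# `p`-power torsion in the fixed field of `ker f` for ANY continuous `f : G_{ℚ_p} → ℤ_p` with OPEN image
# (`⊇ p^s ℤ_p`; the anticyclotomic character RESTRICTED to a decomposition group `G_{K_𝔭}`, whose image is the
# decomposition group of `𝔭` in `Γ ≅ ℤ_p`: open of index `p^s` = the number of primes of `K_∞` above `𝔭`,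
# not all of `ℤ_p` in general) — the form in which (L1) feeds `BigRepLocalInvariants` (object (O2), memo §33.9)

Cell `bsd-stepL` (run/shared/lean/pub/bsd-stepL/), seat `bsd-stepL-bdp` (prover g15, 2026-08-27), memo
`HOME/proof/PROOF-BDP.md` §31.2 (E), §33.11; `--supports stmt-BirchSwinnertonDyer-19702 --as helper`.

g14's `TateTorsionRigidity.zpTower_*` take `κ : ZpExtension ℚ_[p] p` (a SURJECTIVE `Γ_{ℚ_p} ↠ ℤ_p`). The
local character at `𝔭` is `κ ∘ ψ_𝔭 : G_{K_𝔭} = G_{ℚ_p} → ℤ_p` with image `p^s ℤ_p`; this file proves (for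
any continuous `f` whose image CONTAINS some `p^s ℤ_p` — hypothesis `hsurj`) the
degree hypothesis `hdeg` of `curve_smul_eq_self_of_fixed_of_torsion` for the kernel of such an `f`
(`exists_natDegree_minpoly_eq_pow_of_fixed_ker`: a `ker f`-fixed `x ∈ K̄` has `[K(x):K] = p^j` — the
stabiliser of `x` contains `f⁻¹(p^{a+s} ℤ_p)`, an open normal subgroup whose fixed field has `p`-power degree)
and concludes `openImage_curve_smul_eq_self_of_fixed_of_torsion` ∕ `…_exists_generator_…`:
**`E(ℚ̄_p^{ker f})[p^∞] = E(ℚ_p)[p^∞] ≅ ℤ/p^k`** for `E/ℚ` split multiplicative at `p`, `p` odd.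

HONEST FRAMING: theorems only (no definition, no named fact, no `sorry`); that `f` IS the anticyclotomic
character on a decomposition group and that its image contains `p^s ℤ_p` (object (O3): `𝔭` is finitely
decomposed in `K_∞`) are hypotheses, not assertions. Nothing is booked; no census word, tier or label moves (T7).
References: [SilvermanATAEC1994] Thm. V.5.3; [Washington1997] §13.1; memo PROOF-BDP §31.2 (E), §32, §33.9.
-/

set_option autoImplicit false
-- the Theorems namespace of this sub repeats the summit name by design (D-0017 nested layout)
set_option linter.dupNamespace false

noncomputable section

open scoped Classical IntermediateField Topology

namespace Summit.BirchSwinnertonDyer.BirchSwinnertonDyer.Theorems.TateTorsionRigidity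

open Field Polynomial WeierstrassCurve Literature.NumberTheory.EllipticCurves
  Literature.NumberTheory.EllipticCurves.TateCurve

universe u

/-! ### §1 The open normal subgroups `f⁻¹(pⁿ ℤ_p)` of `Γ_K` -/

section General

variable {p : ℕ} [hp : Fact p.Prime] {K : Type u} [Field K]
  (f : absoluteGaloisGroup K →ₜ* Multiplicative ℤ_[p])

/-- Membership in `f⁻¹(pⁿ ℤ_p)`: `pⁿ ∣ f σ`. [folklore] -/
theorem mem_comap_span_pow_iff (n : ℕ) (σ : absoluteGaloisGroup K) :
    σ ∈ Subgroup.comap f.toMonoidHom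
        (AddSubgroup.toSubgroup (Ideal.span {(p : ℤ_[p]) ^ n}).toAddSubgroup) ↔
      (p : ℤ_[p]) ^ n ∣ (f σ).toAdd := by
  rw [Subgroup.mem_comap, Multiplicative.mem_toSubgroup, Submodule.mem_toAddSubgroup,
    Ideal.mem_span_singleton]
  rfl

/-- `f⁻¹(pⁿ ℤ_p)` is open in `Γ_K` (preimage of an open ball under the continuous `f`).
[cite: Washington1997, §13.1] -/
theorem isOpen_comap_span_pow (n : ℕ) :
    IsOpen ((Subgroup.comap f.toMonoidHom
      (AddSubgroup.toSubgroup (Ideal.span {(p : ℤ_[p]) ^ n}).toAddSubgroup) :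
        Subgroup (absoluteGaloisGroup K)) : Set (absoluteGaloisGroup K)) := by
  have hball : ((Ideal.span {(p : ℤ_[p]) ^ n} : Ideal ℤ_[p]) : Set ℤ_[p]) =
      Metric.closedBall (0 : ℤ_[p]) ((p : ℝ) ^ (-n : ℤ)) := by
    ext x
    rw [SetLike.mem_coe, Metric.mem_closedBall, dist_zero_right,
      PadicInt.norm_le_pow_iff_mem_span_pow]
  have hopen : IsOpen ((Ideal.span {(p : ℤ_[p]) ^ n} : Ideal ℤ_[p]) : Set ℤ_[p]) := by
    rw [hball]
    refine IsUltrametricDist.isOpen_closedBall _ (zpow_ne_zero _ ?_)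
    exact_mod_cast hp.out.ne_zero
  exact hopen.preimage (map_continuous f)

/-- `f⁻¹(pⁿ ℤ_p)` has `p`-power index in `Γ_K` (its index is the relative index of `pⁿ ℤ_p` in the image
of `f`, which divides `[ℤ_p : pⁿ ℤ_p] = pⁿ`). [cite: Washington1997, §13.1] -/
theorem exists_index_comap_span_pow_eq (n : ℕ) :
    ∃ j : ℕ, (Subgroup.comap f.toMonoidHom
      (AddSubgroup.toSubgroup (Ideal.span {(p : ℤ_[p]) ^ n}).toAddSubgroup)).index = p ^ j := by
  have hdvd : (Subgroup.comap f.toMonoidHom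
      (AddSubgroup.toSubgroup (Ideal.span {(p : ℤ_[p]) ^ n}).toAddSubgroup)).index ∣ p ^ n := by
    rw [Subgroup.index_comap, ← ZpExtension.index_toSubgroup_span_pow (p := p) n]
    exact Subgroup.relIndex_dvd_index_of_normal _ _
  obtain ⟨j, -, hj⟩ := (Nat.dvd_prime_pow hp.out).mp hdvd
  exact ⟨j, hj⟩

/-- `f⁻¹(pⁿ ℤ_p)`, transported along the identity `Γ_K ≃* (K̄ ≃ₐ[K] K̄)`, is closed (open subgroups are
closed). [folklore] -/
theorem isClosed_map_comap_span_pow (n : ℕ) :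
    IsClosed ((Subgroup.map (absoluteGaloisGroup.toAlgEquiv K).toMonoidHom
      (Subgroup.comap f.toMonoidHom
        (AddSubgroup.toSubgroup (Ideal.span {(p : ℤ_[p]) ^ n}).toAddSubgroup)) :
          Subgroup (AlgebraicClosure K ≃ₐ[K] AlgebraicClosure K)) :
            Set (AlgebraicClosure K ≃ₐ[K] AlgebraicClosure K)) := by
  refine Subgroup.isClosed_of_isOpen _ ?_
  have hHeq : ((Subgroup.map (absoluteGaloisGroup.toAlgEquiv K).toMonoidHom
      (Subgroup.comap f.toMonoidHom
        (AddSubgroup.toSubgroup (Ideal.span {(p : ℤ_[p]) ^ n}).toAddSubgroup)) :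
          Subgroup (AlgebraicClosure K ≃ₐ[K] AlgebraicClosure K)) :
            Set (AlgebraicClosure K ≃ₐ[K] AlgebraicClosure K)) =
      (absoluteGaloisGroup.toAlgEquiv K).symm ⁻¹'
        ((Subgroup.comap f.toMonoidHom
          (AddSubgroup.toSubgroup (Ideal.span {(p : ℤ_[p]) ^ n}).toAddSubgroup) :
            Subgroup (absoluteGaloisGroup K)) : Set (absoluteGaloisGroup K)) := by
    rw [Subgroup.coe_map]
    exact (absoluteGaloisGroup.toAlgEquiv K).toEquiv.image_eq_preimage_symm _
  have hcont : Continuous (absoluteGaloisGroup.toAlgEquiv K).symm := continuous_id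
  rw [hHeq]
  exact (isOpen_comap_span_pow f n).preimage hcont

/-- **The fixed field of `f⁻¹(pⁿ ℤ_p)` has `p`-power degree over `K`** (`K` perfect): Krull–Galois
(`[K̄^H : K] = [Γ_K : H]` for the closed subgroup `H`) and `exists_index_comap_span_pow_eq`.
[cite: Washington1997, §13.1] -/
theorem exists_finrank_fixedField_comap_span_pow_eq [PerfectField K] (n : ℕ) :
    ∃ j : ℕ, Module.finrank K (IntermediateField.fixedField
      (Subgroup.map (absoluteGaloisGroup.toAlgEquiv K).toMonoidHom
        (Subgroup.comap f.toMonoidHom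
          (AddSubgroup.toSubgroup (Ideal.span {(p : ℤ_[p]) ^ n}).toAddSubgroup)))) = p ^ j := by
  obtain ⟨j, hj⟩ := exists_index_comap_span_pow_eq f n
  refine ⟨j, ?_⟩
  have hfix : (IntermediateField.fixedField
      (Subgroup.map (absoluteGaloisGroup.toAlgEquiv K).toMonoidHom
        (Subgroup.comap f.toMonoidHom
          (AddSubgroup.toSubgroup (Ideal.span {(p : ℤ_[p]) ^ n}).toAddSubgroup)))).fixingSubgroup =
      Subgroup.map (absoluteGaloisGroup.toAlgEquiv K).toMonoidHom
        (Subgroup.comap f.toMonoidHom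
          (AddSubgroup.toSubgroup (Ideal.span {(p : ℤ_[p]) ^ n}).toAddSubgroup)) :=
    InfiniteGalois.fixingSubgroup_fixedField (k := K) (K := AlgebraicClosure K)
      ⟨_, isClosed_map_comap_span_pow f n⟩
  rw [IntermediateField.finrank_eq_fixingSubgroup_index, hfix,
    Subgroup.index_map_of_bijective (absoluteGaloisGroup.toAlgEquiv K).bijective, hj]

/-- **Degrees in the fixed field of `ker f` are powers of `p`, for a continuous `f : Γ_K → ℤ_p` whose
image contains `p^s ℤ_p`** (the surjective case `s = 0` is g14's `exists_natDegree_minpoly_eq_pow_of_fixed_kerSubgroup`):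
a `ker f`-fixed `x ∈ K̄` has a stabiliser `S ⊇ ker f` of finite index, whose normal core `C` has finite
index `N = p^a n'`; `σ₀^N ∈ C ⊆ S` for every `σ₀`, and solving `f σ = p^{a+s} z = N·f(σ₀)` in the image
`p^s ℤ_p` gives `S ⊇ f⁻¹(p^{a+s} ℤ_p)`; so `x` lies in the fixed field of that open normal subgroup, and
`[K(x):K]` divides its `p`-power degree. [cite: Washington1997, §13.1] -/
theorem exists_natDegree_minpoly_eq_pow_of_fixed_ker [PerfectField K] {s : ℕ}
    (hsurj : ∀ y : ℤ_[p], ∃ σ : absoluteGaloisGroup K, (f σ).toAdd = (p : ℤ_[p]) ^ s * y)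
    (x : AlgebraicClosure K) (hx : ∀ τ ∈ f.toMonoidHom.ker, τ • x = x) :
    ∃ j : ℕ, (minpoly K x).natDegree = p ^ j := by
  let S : Subgroup (absoluteGaloisGroup K) := MulAction.stabilizer (absoluteGaloisGroup K) x
  have hkerS : f.toMonoidHom.ker ≤ S := fun τ hτ => hx τ hτ
  have hint : IsIntegral K x := Algebra.IsIntegral.isIntegral x
  -- the orbit of `x` is finite, so `S` and its normal core `C` have finite index
  have horb : (MulAction.orbit (absoluteGaloisGroup K) x).Finite := by
    refine ((minpoly K x).rootSet_finite (AlgebraicClosure K)).subset ?_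
    rintro _ ⟨σ, rfl⟩
    rw [Polynomial.mem_rootSet]
    refine ⟨minpoly.ne_zero hint, ?_⟩
    show aeval (absoluteGaloisGroup.toAlgEquiv K σ x) (minpoly K x) = 0
    rw [← minpoly.algEquiv_eq (absoluteGaloisGroup.toAlgEquiv K σ) x]
    exact minpoly.aeval K _
  have hSidx : S.index ≠ 0 := by
    rw [MulAction.index_stabilizer]
    exact ((Set.ncard_pos horb).mpr ⟨x, MulAction.mem_orbit_self x⟩).ne'
  haveI : S.FiniteIndex := ⟨hSidx⟩
  let C : Subgroup (absoluteGaloisGroup K) := S.normalCore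
  have hCS : C ≤ S := Subgroup.normalCore_le S
  have hCidx : C.index ≠ 0 := Subgroup.FiniteIndex.index_ne_zero
  obtain ⟨a, n', hn', hN⟩ := Nat.exists_eq_pow_mul_and_not_dvd hCidx p hp.out.one_lt.ne'
  have hu : IsUnit ((n' : ℕ) : ℤ_[p]) :=
    PadicInt.isUnit_iff.mpr (PadicInt.norm_natCast_eq_one_iff.mpr
      ((Nat.Prime.coprime_iff_not_dvd hp.out).mpr hn'))
  obtain ⟨u, hu'⟩ := hu
  -- `f⁻¹(p^{a+s} ℤ_p) ≤ S`
  have hlay : Subgroup.comap f.toMonoidHom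
      (AddSubgroup.toSubgroup (Ideal.span {(p : ℤ_[p]) ^ (a + s)}).toAddSubgroup) ≤ S := by
    intro σ hσ
    rw [mem_comap_span_pow_iff] at hσ
    obtain ⟨z, hz⟩ := hσ
    obtain ⟨σ₀, hσ₀⟩ := hsurj ((↑u⁻¹ : ℤ_[p]) * z)
    have hτC : σ₀ ^ C.index ∈ C := Subgroup.pow_index_mem C σ₀
    have hfeq : f (σ₀ ^ C.index) = f σ := by
      apply Multiplicative.toAdd.injective
      rw [map_pow, toAdd_pow, hσ₀, hz, hN, nsmul_eq_mul, Nat.cast_mul, Nat.cast_pow, ← hu']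
      have h1 : (u : ℤ_[p]) * (↑u⁻¹ : ℤ_[p]) = 1 := Units.mul_inv u
      calc (p : ℤ_[p]) ^ a * ↑u * ((p : ℤ_[p]) ^ s * (↑u⁻¹ * z))
          = (p : ℤ_[p]) ^ a * (p : ℤ_[p]) ^ s * ((u : ℤ_[p]) * ↑u⁻¹) * z := by ring
        _ = (p : ℤ_[p]) ^ (a + s) * z := by rw [h1, mul_one, pow_add]
    have hmem : σ * (σ₀ ^ C.index)⁻¹ ∈ S := hkerS (by
      rw [MonoidHom.mem_ker, map_mul, map_inv]
      change f σ * (f (σ₀ ^ C.index))⁻¹ = 1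
      rw [hfeq, mul_inv_cancel])
    simpa using S.mul_mem hmem (hCS hτC)
  -- `x` lies in the fixed field of `f⁻¹(p^{a+s} ℤ_p)`, of `p`-power degree
  have hxlay : x ∈ IntermediateField.fixedField
      (Subgroup.map (absoluteGaloisGroup.toAlgEquiv K).toMonoidHom
        (Subgroup.comap f.toMonoidHom
          (AddSubgroup.toSubgroup (Ideal.span {(p : ℤ_[p]) ^ (a + s)}).toAddSubgroup))) := by
    rw [IntermediateField.mem_fixedField_iff]
    rintro φ ⟨σ, hσ, rfl⟩
    exact hlay hσ
  obtain ⟨j, hfin⟩ := exists_finrank_fixedField_comap_span_pow_eq f (a + s)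
  have hadj : Module.finrank K K⟮x⟯ = (minpoly K x).natDegree := IntermediateField.adjoin.finrank hint
  have hle : K⟮x⟯ ≤ IntermediateField.fixedField
      (Subgroup.map (absoluteGaloisGroup.toAlgEquiv K).toMonoidHom
        (Subgroup.comap f.toMonoidHom
          (AddSubgroup.toSubgroup (Ideal.span {(p : ℤ_[p]) ^ (a + s)}).toAddSubgroup))) :=
    IntermediateField.adjoin_simple_le_iff.mpr hxlay
  have hdvd : (minpoly K x).natDegree ∣ p ^ j := by
    rw [← hadj, ← hfin]
    exact IntermediateField.finrank_dvd_of_le_right hle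
  obtain ⟨j', -, hj'⟩ := (Nat.dvd_prime_pow hp.out).mp hdvd
  exact ⟨j', hj'⟩

end General

/-! ### §2 (L1) for the curve along an open-image local character over `ℚ_p` -/

section Padic

variable {p : ℕ} [Fact p.Prime]

/-- **(L1) FOR THE CURVE along an open-image character**: `p` odd, `E = W/ℚ` with SPLIT multiplicative
reduction at `p`, `f : G_{ℚ_p} → ℤ_p` continuous whose image CONTAINS `p^s ℤ_p` (e.g. the anticyclotomic
character on the decomposition group at a prime `𝔭 ∣ p` split in `K`, image `= p^s ℤ_p`;
`L = ℚ̄_p^{ker f} = K_{∞,w}`): every `ker f`-fixed `p`-power-torsion point of `E(ℚ̄_p)` is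
`Gal(ℚ̄_p/ℚ_p)`-fixed — **`E(K_{∞,w})[p^∞] = E(ℚ_p)[p^∞]`**.
[cite: SilvermanATAEC1994, Thm. V.5.3 (PDF pp. 407–409)] [cite: Washington1997, §13.1] -/
theorem openImage_curve_smul_eq_self_of_fixed_of_torsion (hp2 : p ≠ 2)
    (f : absoluteGaloisGroup ℚ_[p] →ₜ* Multiplicative ℤ_[p]) {s : ℕ}
    (hsurj : ∀ y : ℤ_[p], ∃ σ : absoluteGaloisGroup ℚ_[p], (f σ).toAdd = (p : ℤ_[p]) ^ s * y)
    (W : WeierstrassCurve ℚ) [W.IsElliptic] (hsplit : W.HasSplitMultiplicativeReductionAtPrime p)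
    (P : geomPoints (W.baseChange ℚ_[p])) {n : ℕ} (hP : (p ^ n) • P = 0)
    (hfix : ∀ τ ∈ f.toMonoidHom.ker, τ • P = P) (σ : absoluteGaloisGroup ℚ_[p]) : σ • P = P :=
  curve_smul_eq_self_of_fixed_of_torsion hp2 W hsplit f.toMonoidHom.ker
    (fun x hx => exists_natDegree_minpoly_eq_pow_of_fixed_ker f hsurj x hx) P hP hfix σ

/-- **(L1) along an open-image character, structure form**: there are `k : ℕ` and ONE `Gal(ℚ̄_p/ℚ_p)`-fixed
`P₀ ∈ E(ℚ̄_p)` of exact order `p^k` such that every `ker f`-fixed `p`-power-torsion point is an integer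
multiple of `P₀` — `E(K_{∞,w})[p^∞] = E(ℚ_p)[p^∞] ≅ ℤ/p^k`, `#H⁰(K_{∞,w}, E[p^∞]) = p^k` (the constant `c₀`
of memo §31.2 (E), the input `hA₀`/`hc` of `BigRepLocalInvariants`).
[cite: SilvermanATAEC1994, Thm. V.5.3 (PDF pp. 407–409)] [cite: Washington1997, §13.1] -/
theorem openImage_curve_exists_generator_fixed_torsion (hp2 : p ≠ 2)
    (f : absoluteGaloisGroup ℚ_[p] →ₜ* Multiplicative ℤ_[p]) {s : ℕ}
    (hsurj : ∀ y : ℤ_[p], ∃ σ : absoluteGaloisGroup ℚ_[p], (f σ).toAdd = (p : ℤ_[p]) ^ s * y)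
    (W : WeierstrassCurve ℚ) [W.IsElliptic] (hsplit : W.HasSplitMultiplicativeReductionAtPrime p) :
    ∃ (k : ℕ) (P₀ : geomPoints (W.baseChange ℚ_[p])),
      (∀ σ : absoluteGaloisGroup ℚ_[p], σ • P₀ = P₀) ∧ (p ^ k) • P₀ = 0 ∧
      (∀ j : ℕ, j • P₀ = 0 → p ^ k ∣ j) ∧
      ∀ (P : geomPoints (W.baseChange ℚ_[p])) (n : ℕ), (p ^ n) • P = 0 →
        (∀ τ ∈ f.toMonoidHom.ker, τ • P = P) → ∃ j : ℤ, P = j • P₀ :=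
  curve_exists_generator_fixed_torsion hp2 W hsplit f.toMonoidHom.ker
    (fun x hx => exists_natDegree_minpoly_eq_pow_of_fixed_ker f hsurj x hx)

end Padic

end Summit.BirchSwinnertonDyer.BirchSwinnertonDyer.Theorems.TateTorsionRigidity

end
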